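import Mathlib
import Summits.Ventures.HodgeRepro.Tier4.Common.AdelicDefs

/-!
# Tier4/Line1/PlaneDefs — the DEFINED predicates of Line 1 on a `PlaneData` (v0.2)

Blind re-derivation cell `pub-hodge-repro`, Tier 4, LINE L1 (relative-trace-formula line, seat t4-plan-1).  Definitions
only, served so that the instance lemmas of the line (Tier4/Line1/Skeleton.lean Part I′) can be restated by name in
prover modules:

* `IsDefinite W` — the plane is definite at a real place of `k` (the seesaw plane of the face is: Liu 2021 Lemma D.2(2));
* `IsGenuine W` — v0.1's genuineness predicate in the COLUMN convention (DEPRECATED, kept verbatim: the tree is append-only);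
* `IsGenuineRow W` (v0.2) — the plane is a genuine `E′`-hermitian plane with two orthogonal decompositions into `E′`-lines,
  in the ROW convention of `Common.unitaryGroup` (the junk test `P 0 = 0`, `P 1 = 1` makes both tori the whole group and
  refutes the heart lemma J2 as typed in v0.8/v0.9);
* `IsRegularRational W γ₀` — the adelic stabiliser of the rational point `γ₀` in `T × T′` is the diagonal centre
  (Jacquet's regular double cosets);
* `IsLinRegular W γ₀` (v0.2) — LINEAR regularity: the adelic solutions `(Y, Y′)` of `Y γ₀ = γ₀ Y′` with `Y` in the
  commutant algebra of `T` and `Y′` in that of `T′` are the diagonal `E′_𝔸`-scalars.  It implies `IsRegularRational`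
  (restrict to unitaries) and it is what the Hasse-principle lemma J2.b of the skeleton actually uses: the rational
  linear system «`X ∈ A_T`, `X′ ∈ A_{T′}`, `X γ₀ = γ X′`, `P 0 · X = P 0`» then has a UNIQUE adelic solution, and a
  rational linear system with a unique adelic solution has a rational one.

v0.2 (t4-L1-p3's interface defect L1-#1, S12500): `IsGenuineRow` is `IsGenuine` written in the ROW convention of typer-2's group —
`unitaryGroup W = {g | g Ω = Ω g ∧ g B gᵀ = B}` is the isometry group of the form `β(u, v) = u B vᵀ` on ROW vectors with
`E′` acting by `v ↦ v Ω`; the trace form of an `E′`-hermitian form satisfies `β(uΩ, v) = −β(u, vΩ)`, i.e. `Ω B = −B Ωᵀ`,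
and a `β`-self-adjoint projector satisfies `P B = B Pᵀ`.  v0.1 wrote the COLUMN relations `Ωᵀ B = −B Ω`, `Pᵀ B = B P`,
for which `unitaryGroup W` is not the unitary group of the plane (p3's exact-arithmetic witness: tangent dimension 1 or 0
instead of 4); the gate is append-only (`theorems.append-only`), so `IsGenuine` stays as filed and the line moves to
`IsGenuineRow` (same six conjuncts in the same order).

Every object is typer-2's (`PlaneData`, `GA`, `rationalPoints`, `torusT`, `torusT'`, `centre`, `adMat`, `GA.mat`, `M4`,
`Ad` of `AdelicDefs`) or Mathlib's (`Matrix.PosDef`, `Matrix.rank`, `IsSquare`).  No theorem is stated here.  HC_CM is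
NOT proved by anyone in this repository.
-/

noncomputable section

namespace Summit.Ventures.HodgeRepro.Tier4.Line1

open NumberField Summit.Ventures.HodgeRepro.Tier4.Common

variable {k : Type} [Field k] [NumberField k] (W : PlaneData k)

/-- **The plane is definite at a real place of `k`**: under some real embedding `σ` the symmetric matrix `B` of the
hermitian form is positive or negative definite (Mathlib's `Matrix.PosDef`).  The seesaw plane of the face is definite
at `w₀ = τ₀|_{E′⁺}` (Liu 2021 Lemma D.2(2), t4-lit-5 S12008). -/
def IsDefinite : Prop := ∃ σ : k →+* ℝ, (W.B.map σ).PosDef ∨ (-(W.B.map σ)).PosDef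

/-- **The plane is genuine** (v0.1, COLUMN convention — DEPRECATED in v0.2, kept verbatim because the tree is append-only
(`theorems.append-only`): use `IsGenuineRow`).  `Ω² = −d` with `−d` not a square, `Ωᵀ B = −B Ω`, `B`-self-adjoint rank-2
projectors in the column reading `Pᵀ B = B P`.  For this predicate typer-2's `unitaryGroup W` is NOT the unitary group of the
plane (t4-L1-p3's interface defect L1-#1, S12500); the only landed consumer, p3's `isRegularRational_one` (ThreeLines
p665354), uses just the first conjunct and the ranks, which `IsGenuineRow` shares.  THE JUNK TEST that forced a genuineness
predicate (20:0xZ): `P 0 = 0`, `P 1 = 1` satisfy every field of `PlaneData`, give `T = T′ = G`, and REFUTE J2 as typed in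
v0.8/v0.9 — see the J2 docstring of the skeleton. -/
def IsGenuine : Prop :=
  (∃ d : k, W.Ω * W.Ω = -(d • (1 : Matrix (Fin 4) (Fin 4) k)) ∧ ¬ IsSquare (-d)) ∧
  W.Ω.transpose * W.B = -(W.B * W.Ω) ∧
  (∀ i, (W.P i).transpose * W.B = W.B * W.P i) ∧ (∀ i, (W.Q i).transpose * W.B = W.B * W.Q i) ∧
  (∀ i, (W.P i).rank = 2) ∧ (∀ i, (W.Q i).rank = 2)

/-- **The plane is genuine** (v0.2, ROW convention — the predicate of the line from v0.17 on): `Ω² = −d` with `−d` not a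
square (so `k[Ω] = E′` is a quadratic field and `V = k⁴` an `E′`-plane, `E′` acting on row vectors by `v ↦ v Ω`),
`Ω B = −B Ωᵀ` (`B` is the trace form of an `E′`-hermitian form `h` for the row form `β(u, v) = u B vᵀ`, the one preserved
by typer-2's `unitaryGroup W = {g | g Ω = Ω g ∧ g B gᵀ = B}`), the projectors of both tori are `β`-self-adjoint
(`P B = B Pᵀ`: orthogonal decompositions) and of rank `2` (`E′`-lines).  Same six conjuncts in the same order as
`IsGenuine`, so a destructuring `⟨⟨d, hΩ, hd⟩, _, _, _, hP, hQ⟩` reads either. -/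
def IsGenuineRow : Prop :=
  (∃ d : k, W.Ω * W.Ω = -(d • (1 : Matrix (Fin 4) (Fin 4) k)) ∧ ¬ IsSquare (-d)) ∧
  W.Ω * W.B = -(W.B * W.Ω.transpose) ∧
  (∀ i, W.P i * W.B = W.B * (W.P i).transpose) ∧ (∀ i, W.Q i * W.B = W.B * (W.Q i).transpose) ∧
  (∀ i, (W.P i).rank = 2) ∧ (∀ i, (W.Q i).rank = 2)

/-- **`γ₀` is (adelically) regular**: its stabiliser in `T × T′` under `(t, t′) · γ = t⁻¹ γ t′` is the diagonal centre
(Jacquet's regular double cosets; for a genuine plane this says `{γ₀ W′₀, γ₀ W′₁} ≠ {W₀, W₁}`). -/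
def IsRegularRational (γ₀ : rationalPoints W) : Prop :=
  ∀ t ∈ torusT W, ∀ t' ∈ torusT' W, t⁻¹ * γ₀ * t' = γ₀ → t ∈ centre W ∧ t' = t

/-- **`γ₀` is LINEARLY regular** (v0.2): every pair of adelic matrices `Y` commuting with `Ω`, `P 0`, `P 1` (the
commutant algebra of `T`) and `Y′` commuting with `Ω`, `Q 0`, `Q 1` (that of `T′`) with `Y γ₀ = γ₀ Y′` is ONE
`E′_𝔸`-scalar `x · 1 + y · Ω`.  For a genuine plane it holds as soon as the `E′`-line `γ₀ (im Q 0) γ₀⁻¹` is neither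
`P`-line (p3's `mat_eq_scalar_of_three_lines`), and it gives `IsRegularRational` by restricting to unitaries. -/
def IsLinRegular (γ₀ : rationalPoints W) : Prop :=
  ∀ Y Y' : M4 k,
    Y * adMat k W.Ω = adMat k W.Ω * Y → (∀ i, Y * adMat k (W.P i) = adMat k (W.P i) * Y) →
    Y' * adMat k W.Ω = adMat k W.Ω * Y' → (∀ i, Y' * adMat k (W.Q i) = adMat k (W.Q i) * Y') →
    Y * GA.mat W (γ₀ : GA W) = GA.mat W (γ₀ : GA W) * Y' →
    ∃ x y : Ad k, Y = x • (1 : M4 k) + y • adMat k W.Ω ∧ Y' = x • (1 : M4 k) + y • adMat k W.Ω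

end Summit.Ventures.HodgeRepro.Tier4.Line1

end
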